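import Literature.NumberTheory.LFunctions.UniformTwistedZeroFreeRegion
import HarnessLib

/-!
# The zero-free region for twisted `L`-functions, uniformly in the field AND its degree
# (MV §11.1 with an abstract size functional; Lagarias–Odlyzko Lemma 8.1)

Topic `Literature/NumberTheory/LFunctions`, a variant of `UniformTwistedZeroFreeRegion.lean`
(Montgomery–Vaughan, Theorem 11.3, run once for an abstract datum). Everything in this file is
PROVED (theorems only; no named facts).

**Purpose.** `UniformTwistedZeroFreeRegion.lean` proves, for a datum
`UniformTwistedZFRData η A C_g c₁ K₀ C₂ pole Q Λ₀ Λ₁ Λ₂ F`, that `F` has no zeros in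
`σ > 1 − c/(log Q + log(|t| + 4))` with `c = c(η, A, C_g, c₁, K₀, C₂)`.  For the Hecke / class-group
`L`-functions of a number field `K` of degree `n_K` the growth exponent is `A = n_K + 1`
(`|L(s, χ)| ≪ |d_K| e^{O(n_K)} (|t| + 6)^{n_K + 1}` by convexity) and the lower bound at the disc
centres is `e^{−O(n_K)}`, so that `c` depends on the degree — whereas Lagarias–Odlyzko
(Lemma 8.1) and Thorner–Zaman (*A unified and improved Chebotarev density theorem*, ANT 13 (2019),
Theorem 3.1) have the region `σ > 1 − c/log(d_K (|t| + 3)^{n_K})` with `c` ABSOLUTE: the degree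
enters only through the SIZE `𝓛(t) = log d_K + n_K log(|t| + 3)`.

Montgomery–Vaughan's argument gives exactly this once the three places where `Q` and `t` enter —
the growth of `F`, the lower bound at the disc centres, and the constant terms `K₀`, `C₂` of the
two logarithmic-derivative inequalities — are all measured by ONE abstract size functional
`𝓛 : ℝ → ℝ` (`DegreeUniformTwistedZFRData η G G' K₀ C₂ pole 𝓛 Λ₀ Λ₁ Λ₂ F`):

* `‖F(s)‖ ≤ exp(G 𝓛(t))` on `1 − η < σ ≤ 3` and `‖F(1 + η/32 + it)‖ ≥ exp(−G' 𝓛(t))`, so that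
  Titchmarsh's Lemma α (MV Lemma 11.1) gives `|ψ| ≤ E 𝓛(t)` with `E = E(η, G, G')`;
* `Re L(Λ₀, σ) ≤ 1/(σ−1) + K₀ 𝓛(0)`, `Re L(Λ₂, s) ≤ [Re 1/(s−1)] + C₂ 𝓛(t)`;
* `𝓛 ≥ 1`, `𝓛(2t) ≤ 2𝓛(t)`, `𝓛(0) ≤ 𝓛(t)`, `𝓛(t') ≤ 2𝓛(t)` for `|t' − t| ≤ 1` (all satisfied by
  `𝓛(t) = a + b log(|t| + 4)`, `a, b ≥ 0`, `a + b log 4 ≥ 1`).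

The conclusion (`zeroFree_of_le`, `exists_zeroFree_const`) is the region `σ > 1 − c/𝓛(t)` with
`c = c(η, G, G', K₀, C₂)` INDEPENDENT of `𝓛` — for `𝓛(t) = log|d_K| + (n_K + 1) log(|t| + 4) + O(n_K)`
this is the Lagarias–Odlyzko / Thorner–Zaman region with an absolute constant.  The proofs are those
of `UniformTwistedZeroFreeRegion.lean` VERBATIM with `log Q + log(|t| + 4)` replaced by `𝓛(t)`
(only MV Lemma 11.1, `exists_package`, changes: the maximum modulus on the disc `|z − c| ≤ η/2` is
`≤ exp(2G 𝓛(t))` by `𝓛(Im z) ≤ 2𝓛(t)`); `of_uniformTwistedZFRData` shows that every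
`UniformTwistedZFRData` is a `DegreeUniformTwistedZFRData` with `𝓛(t) = log Q + log(|t| + 4)`, so the
present theorems contain those of the two earlier files.

## References

* H. L. Montgomery, R. C. Vaughan, *Multiplicative Number Theory I. Classical Theory*, Cambridge
  Stud. Adv. Math. 97 (2007), §11.1, Theorem 11.3 (proof, pp. 275–277).
  [cite: MontgomeryVaughan2007, §11.1 Theorem 11.3]
* J. C. Lagarias, A. M. Odlyzko, *Effective versions of the Chebotarev density theorem*, in:
  Algebraic Number Fields (Durham 1975), Academic Press 1977, §8, Lemma 8.1 (zero-free region
  `σ ≥ 1 − c/log(d_L (|t|+2)^{n_L})`, `c` absolute). [cite: LagariasOdlyzko1977, Lemma 8.1]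
* J. Thorner, A. Zaman, *A unified and improved Chebotarev density theorem*, Algebra & Number
  Theory 13 (2019), Theorem 3.1. [cite: ThornerZaman2019, Theorem 3.1]

## Mathlib / tree search

Tree: `TwistedZFRData`, `UniformTwistedZFRData` and their theorems (constants depending on the
growth exponent `A`, see above); `ClassicalZFRData`; `DirichletZFR.*`. Mathlib: nothing on
zero-free regions beyond non-vanishing on `σ = 1`.
-/

noncomputable section

open Complex Filter Topology Metric Set Finset
open scoped ComplexConjugate

namespace Literature.NumberTheory.LFunctions

/-! ## The hypotheses -/

/-- **Hypotheses of the zero-free-region argument for a twisted `L`-function `F`, measured by an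
abstract size functional `𝓛`** (model: `F = L(s, χ)` for a class-group or Hecke character `χ` of a
number field `K`, `𝓛(t) = log|d_K| + (n_K + 1) log(|t| + 4) + O(n_K)`; `Λ₀ = Λ_K`, `Λ₁ = χΛ_K`,
`Λ₂ = χ²Λ_K`): the datum `UniformTwistedZFRData` of `UniformTwistedZeroFreeRegion.lean` with
`log Q + log(|t| + 4)` replaced by `𝓛(t)` throughout, the growth bound in the form
`‖F(s)‖ ≤ exp(G 𝓛(t))` and the lower bound at the disc centres in the form
`‖F(1 + η/32 + it)‖ ≥ exp(−G' 𝓛(t))`. See the file docstring.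
[cite: MontgomeryVaughan2007, §11.1 (Lemmas 11.1–11.2); LagariasOdlyzko1977, Lemma 8.1] -/
structure DegreeUniformTwistedZFRData (η G G' K₀ C₂ : ℝ) (pole : Bool) (𝓛 : ℝ → ℝ)
    (Λ₀ : ℕ → ℝ) (Λ₁ Λ₂ : ℕ → ℂ) (F : ℂ → ℂ) : Prop where
  eta_pos : 0 < η
  eta_le_one : η ≤ 1
  G_nonneg : 0 ≤ G
  G'_nonneg : 0 ≤ G'
  K₀_nonneg : 0 ≤ K₀
  C₂_nonneg : 0 ≤ C₂
  /-- The size functional is at least `1`. -/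
  one_le_ell : ∀ t : ℝ, 1 ≤ 𝓛 t
  /-- Doubling the ordinate at most doubles the size. -/
  ell_two_mul_le : ∀ t : ℝ, 𝓛 (2 * t) ≤ 2 * 𝓛 t
  /-- Height `0` is the lowest. -/
  ell_zero_le : ∀ t : ℝ, 𝓛 0 ≤ 𝓛 t
  /-- Nearby ordinates have comparable size. -/
  ell_le_of_near : ∀ t t' : ℝ, |t' - t| ≤ 1 → 𝓛 t' ≤ 2 * 𝓛 t
  /-- `Λ₀ ≥ 0`. -/
  nonneg : ∀ n, 0 ≤ Λ₀ n
  /-- `∑ Λ₀(n) n^{-s}` converges absolutely for `σ > 1`. -/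
  summable : ∀ s : ℂ, 1 < s.re → LSeriesSummable (fun n ↦ (Λ₀ n : ℂ)) s
  /-- `Re L(Λ₀, σ) ≤ 1/(σ − 1) + K₀ 𝓛(0)` for `1 < σ ≤ 2` (the pole of `ζ_K`; Stark's lemma). -/
  re_LSeries₀_le : ∀ σ : ℝ, 1 < σ → σ ≤ 2 →
    (LSeries (fun n ↦ (Λ₀ n : ℂ)) σ).re ≤ 1 / (σ - 1) + K₀ * 𝓛 0
  /-- `|Λ₁| ≤ Λ₀`. -/
  norm_le₁ : ∀ n, ‖Λ₁ n‖ ≤ Λ₀ n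
  /-- `|Λ₂| ≤ Λ₀`. -/
  norm_le₂ : ∀ n, ‖Λ₂ n‖ ≤ Λ₀ n
  /-- `3-4-1`: `3 Re L(Λ₀,σ) + 4 Re L(Λ₁,σ+it) + Re L(Λ₂,σ+2it) ≥ 0` for `σ > 1`. -/
  three_four_one : ∀ σ : ℝ, 1 < σ → ∀ t : ℝ,
    0 ≤ 3 * (LSeries (fun n ↦ (Λ₀ n : ℂ)) σ).re + 4 * (LSeries Λ₁ (σ + t * I)).re +
      (LSeries Λ₂ (σ + 2 * t * I)).re
  /-- `F` is holomorphic on `σ > 1 − η`. -/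
  differentiableOn : DifferentiableOn ℂ F {s : ℂ | 1 - η < s.re}
  /-- `F ≠ 0` on `σ > 1`. -/
  ne_zero : ∀ s : ℂ, 1 < s.re → F s ≠ 0
  /-- `F'/F = −L(Λ₁, ·)` on `σ > 1`. -/
  logDeriv_eq : ∀ s : ℂ, 1 < s.re → deriv F s / F s = -LSeries Λ₁ s
  /-- Growth measured by the size functional: `|F(s)| ≤ exp(G 𝓛(t))` for `1 − η < σ ≤ 3`. -/
  growth : ∀ s : ℂ, 1 - η < s.re → s.re ≤ 3 → ‖F s‖ ≤ Real.exp (G * 𝓛 s.im)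
  /-- Lower bound at the disc centres: `exp(−G' 𝓛(t)) ≤ |F(1 + η/32 + it)|` for all real `t`. -/
  lower : ∀ t : ℝ, Real.exp (-(G' * 𝓛 t)) ≤ ‖F (1 + η / 32 + t * I)‖
  /-- The companion bound for `Λ₂` (with the pole term iff `pole`). -/
  re_LSeries₂_le : ∀ s : ℂ, 1 < s.re → s.re ≤ 2 →
    (LSeries Λ₂ s).re ≤ (if pole then (1 / (s - 1)).re else 0) + C₂ * 𝓛 s.im
  /-- Reflection symmetry of the zeros in the `pole` (real-character) case. -/
  reflect : pole = true → ∀ ρ : ℂ, 1 - η < ρ.re → F ρ = 0 → F (conj ρ) = 0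

namespace DegreeUniformTwistedZFRData

variable {η G G' K₀ C₂ : ℝ} {pole : Bool} {𝓛 : ℝ → ℝ} {Λ₀ : ℕ → ℝ} {Λ₁ Λ₂ : ℕ → ℂ} {F : ℂ → ℂ}

/-- Local notation for the package constant `E(η, G, G') = 8(2G + G' + 1)/(η/4)`. -/
local notation3 "E[" η "," G "," G' "]" =>
  (8 * (2 * (G : ℝ) + (G' : ℝ) + 1) / ((η : ℝ) / 4))

section Package

variable (h : DegreeUniformTwistedZFRData η G G' K₀ C₂ pole 𝓛 Λ₀ Λ₁ Λ₂ F)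
include h

/-- A zero of `F` in the half-plane has real part `≤ 1`. [folklore] -/
theorem re_le_one_of_zero {a : ℂ} (ha : F a = 0) : a.re ≤ 1 := by
  by_contra hcon
  exact h.ne_zero a (not_le.1 hcon) ha

/-- `0 < 𝓛(t)`. [folklore] -/
theorem ell_pos (t : ℝ) : 0 < 𝓛 t := one_pos.trans_le (h.one_le_ell t)

/-- `0 ≤ E(η, G, G')`. [folklore] -/
theorem packageConst_nonneg : 0 ≤ E[η, G, G'] := by
  have := h.eta_pos
  have := h.G_nonneg
  have := h.G'_nonneg
  positivity

/-- **Montgomery–Vaughan Lemma 11.1 for `F`, size-functional form** (Titchmarsh's Lemma α on the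
disc centred at `c = 1 + η/32 + it`, radius `η/4`): the zeros of `F` in `|a − c| ≤ η/4` form a
finite set `S` with multiplicities `m ≥ 1`, and `F'/F(z) = ∑_{a ∈ S} m(a)/(z − a) + ψ(z)` on
`|z − c| < η/4` (off the zeros) with `|ψ(z)| ≤ E 𝓛(t)` for `|z − c| ≤ η/16`, `E = E(η, G, G')`
independent of `𝓛`, `t` and the datum: `|F| ≤ exp(2G 𝓛(t))` on `|z − c| ≤ η/2` (`𝓛(Im z) ≤ 2𝓛(t)`)
and `|F(c)| ≥ exp(−G' 𝓛(t))` give `log(M/|F(c)|) ≤ (2G + G') 𝓛(t)`.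
[cite: MontgomeryVaughan2007, Lemma 11.1] -/
theorem exists_package (t : ℝ) :
    ∃ (S : Finset ℂ) (m : ℂ → ℕ) (ψ : ℂ → ℂ),
      (∀ a ∈ S, F a = 0 ∧ 0 < m a ∧ ‖a - (1 + η / 32 + t * I)‖ ≤ η / 4) ∧
      (∀ a, F a = 0 → ‖a - (1 + η / 32 + t * I)‖ ≤ η / 4 → a ∈ S) ∧
      (∀ z ∈ ball (1 + η / 32 + t * I) (η / 4), F z ≠ 0 →
        ψ z = deriv F z / F z - ∑ a ∈ S, (m a : ℂ) / (z - a)) ∧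
      (∀ z ∈ closedBall (1 + η / 32 + t * I) (η / 16),
        ‖ψ z‖ ≤ E[η, G, G'] * 𝓛 t) := by
  have hη := h.eta_pos
  have hη1 := h.eta_le_one
  have hG := h.G_nonneg
  have hG' := h.G'_nonneg
  have hℒ1 : 1 ≤ 𝓛 t := h.one_le_ell t
  set R : ℝ := η / 4 with hR
  have hRpos : 0 < R := by positivity
  set c : ℂ := 1 + η / 32 + t * I with hc
  have hcre : c.re = 1 + η / 32 := by simp [hc]
  have hcim : c.im = t := by simp [hc]
  -- lower bound at the centre
  have hg₀pos : 0 < Real.exp (-(G' * 𝓛 t)) := Real.exp_pos _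
  have hcentre : Real.exp (-(G' * 𝓛 t)) ≤ ‖F c‖ := h.lower t
  have hGc : 0 < ‖F c‖ := hg₀pos.trans_le hcentre
  have hFc : F c ≠ 0 := norm_pos_iff.1 hGc
  -- holomorphy on `ball c η`
  have hdiff : DifferentiableOn ℂ F (ball c η) := by
    refine h.differentiableOn.mono fun z hz ↦ ?_
    simp only [Set.mem_setOf_eq]
    have h1 : |(z - c).re| ≤ ‖z - c‖ := abs_re_le_norm _
    rw [mem_ball_iff_norm] at hz
    rw [Complex.sub_re, hcre] at h1
    have := neg_abs_le (z.re - (1 + η / 32))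
    linarith
  -- the bound `M = exp(2G 𝓛(t))` on `|z - c| ≤ 2R = η/2`
  set M : ℝ := Real.exp (2 * G * 𝓛 t) with hM
  have hMpos : 0 < M := Real.exp_pos _
  have hMbound : ∀ z ∈ closedBall c (2 * R), ‖F z‖ ≤ M := by
    intro z hz
    rw [mem_closedBall_iff_norm] at hz
    have h1 : |(z - c).re| ≤ ‖z - c‖ := abs_re_le_norm _
    have h2 : |(z - c).im| ≤ ‖z - c‖ := abs_im_le_norm _
    rw [Complex.sub_re, hcre] at h1
    rw [Complex.sub_im, hcim] at h2
    have hre1 : 1 - η < z.re := by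
      have := neg_abs_le (z.re - (1 + η / 32)); rw [hR] at hz; linarith
    have hre2 : z.re ≤ 3 := by
      have := le_abs_self (z.re - (1 + η / 32)); rw [hR] at hz; linarith
    refine (h.growth z hre1 hre2).trans ?_
    rw [hM, Real.exp_le_exp]
    have him : |z.im - t| ≤ 1 := by rw [hR] at hz; linarith
    have hnear := h.ell_le_of_near t z.im him
    nlinarith
  obtain ⟨S, m, ψ, hS, hS', -, hψ, hψb, -⟩ :=
    Literature.Analysis.Complex.titchmarsh_logDeriv_sub_sum_of_differentiableOn hdiff
      (by rw [hR]; linarith) hFc hRpos hMbound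
  refine ⟨S, m, ψ, ?_, ?_, ?_, fun z hz ↦ ?_⟩
  · simpa only [hR] using hS
  · simpa only [hR] using hS'
  · simpa only [hR] using hψ
  have hz' : z ∈ closedBall c (R / 4) := by rw [hR]; convert hz using 2; ring
  refine (hψb z hz').trans ?_
  -- `log(M/‖F c‖) ≤ (2G + G') 𝓛(t)`
  have hlogM : Real.log (M / ‖F c‖) ≤ (2 * G + G') * 𝓛 t := by
    have hMle : M / ‖F c‖ ≤ Real.exp ((2 * G + G') * 𝓛 t) := by
      rw [div_le_iff₀ hGc, show (2 * G + G') * 𝓛 t = 2 * G * 𝓛 t + G' * 𝓛 t by ring,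
        Real.exp_add, ← hM]
      have h1 : 1 ≤ Real.exp (G' * 𝓛 t) * ‖F c‖ := by
        have := mul_le_mul_of_nonneg_left hcentre (Real.exp_pos (G' * 𝓛 t)).le
        rwa [← Real.exp_add, add_neg_cancel, Real.exp_zero] at this
      nlinarith [mul_le_mul_of_nonneg_left h1 hMpos.le]
    have hMpos' : 0 < M / ‖F c‖ := div_pos hMpos hGc
    calc Real.log (M / ‖F c‖) ≤ Real.log (Real.exp ((2 * G + G') * 𝓛 t)) :=
          Real.log_le_log hMpos' hMle
      _ = (2 * G + G') * 𝓛 t := Real.log_exp _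
  have hfinal : 8 * (Real.log (M / ‖F c‖) + 1) / R ≤ 8 * (2 * G + G' + 1) / R * 𝓛 t := by
    calc 8 * (Real.log (M / ‖F c‖) + 1) / R ≤ 8 * ((2 * G + G') * 𝓛 t + 1 * 𝓛 t) / R := by
          gcongr; simpa using hℒ1
      _ = 8 * (2 * G + G' + 1) / R * 𝓛 t := by ring
  convert hfinal using 2

end Package

/-! ## The basic inequalities (MV (11.2), (11.3)) -/

section Inequalities

variable (h : DegreeUniformTwistedZFRData η G G' K₀ C₂ pole 𝓛 Λ₀ Λ₁ Λ₂ F)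
include h

/-- First inequality of MV (11.2): `Re L(Λ₀, 1 + δ) ≤ 1/δ + K₀ 𝓛(0)` for `0 < δ ≤ 1`.
[cite: MontgomeryVaughan2007, Theorem 11.3 (proof, eq. (11.2))] -/
theorem re_LSeries₀_le_of_pos {d : ℝ} (hd : 0 < d) (hd1 : d ≤ 1) :
    (LSeries (fun n ↦ (Λ₀ n : ℂ)) ((1 + d : ℝ) : ℂ)).re ≤
      1 / d + K₀ * (𝓛 0) := by
  have := h.re_LSeries₀_le (1 + d) (by linarith) (by linarith)
  rwa [show (1 + d : ℝ) - 1 = d by ring] at this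

/-- The companion bound with the pole term always allowed:
`Re L(Λ₂, s) ≤ Re 1/(s−1) + C₂ 𝓛(t)` for `1 < σ ≤ 2` (if `pole = false` the
hypothesis is stronger, `Re 1/(s − 1) ≥ 0`). [folklore] -/
theorem re_LSeries₂_le_pole (s : ℂ) (hs : 1 < s.re) (hs2 : s.re ≤ 2) :
    (LSeries Λ₂ s).re ≤ (1 / (s - 1)).re + C₂ * (𝓛 s.im) := by
  have h1 := h.re_LSeries₂_le s hs hs2
  have hpos : 0 ≤ (1 / (s - 1)).re := by
    rw [one_div, Complex.inv_re]
    exact div_nonneg (by simp; linarith) (Complex.normSq_nonneg _)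
  cases pole
  · simp only [Bool.false_eq_true, ↓reduceIte, zero_add] at h1; linarith
  · simpa using h1

/-- The companion bound without pole (`pole = false`):
`Re L(Λ₂, s) ≤ C₂ 𝓛(t)` for `1 < σ ≤ 2`. [folklore] -/
theorem re_LSeries₂_le_noPole (hpole : pole = false) (s : ℂ) (hs : 1 < s.re) (hs2 : s.re ≤ 2) :
    (LSeries Λ₂ s).re ≤ C₂ * (𝓛 s.im) := by
  have h1 := h.re_LSeries₂_le s hs hs2
  subst hpole
  simpa using h1

/-- Second inequality of MV (11.2): if `β + iγ` is a zero of `F` with `β ≥ 1 − 7η/32`, then for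
`0 < δ ≤ 3η/32`, `Re L(Λ₁, 1 + δ + iγ) = −Re F'/F(1+δ+iγ) ≤ E 𝓛(γ) − 1/(1 + δ − β)`
(package at height `γ`: every `Re 1/(s₀ − a)` is non-negative and the zero itself contributes
`1/(1 + δ − β)`). [cite: MontgomeryVaughan2007, Theorem 11.3 (proof, eq. (11.2))] -/
theorem re_LSeries₁_le_of_zero {E : ℝ}
    (hpack : ∀ t : ℝ, ∃ (S : Finset ℂ) (m : ℂ → ℕ) (ψ : ℂ → ℂ),
      (∀ a ∈ S, F a = 0 ∧ 0 < m a ∧ ‖a - (1 + η / 32 + t * I)‖ ≤ η / 4) ∧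
      (∀ a, F a = 0 → ‖a - (1 + η / 32 + t * I)‖ ≤ η / 4 → a ∈ S) ∧
      (∀ z ∈ ball (1 + η / 32 + t * I) (η / 4), F z ≠ 0 →
        ψ z = deriv F z / F z - ∑ a ∈ S, (m a : ℂ) / (z - a)) ∧
      (∀ z ∈ closedBall (1 + η / 32 + t * I) (η / 16),
        ‖ψ z‖ ≤ E * (𝓛 t)))
    {β γ d : ℝ} (hzero : F (β + γ * I) = 0) (hβ : 1 - 7 * η / 32 ≤ β) (hd : 0 < d)
    (hd1 : d ≤ 3 * η / 32) :
    (LSeries Λ₁ (((1 + d : ℝ) : ℂ) + γ * I)).re ≤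
      E * (𝓛 γ) - 1 / (1 + d - β) := by
  have hη := h.eta_pos
  obtain ⟨S, m, ψ, hS, hS', hψ, hψb⟩ := hpack γ
  set s₀ : ℂ := ((1 + d : ℝ) : ℂ) + γ * I with hs₀
  have hs₀re : s₀.re = 1 + d := by simp [hs₀]
  have hs₀1 : 1 < s₀.re := by rw [hs₀re]; linarith
  have hβ1 : β ≤ 1 := by
    have := h.re_le_one_of_zero hzero; simpa using this
  set c : ℂ := 1 + η / 32 + γ * I with hcdef
  have hs₀c : ‖s₀ - c‖ ≤ η / 16 := by
    have : s₀ - c = ((d - η / 32 : ℝ) : ℂ) := by simp only [hs₀, hcdef]; push_cast; ring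
    rw [this, Complex.norm_real, Real.norm_eq_abs, abs_le]
    constructor <;> linarith
  have hs₀ball : s₀ ∈ ball c (η / 4) := mem_ball_iff_norm.2 (by linarith)
  have hs₀cl : s₀ ∈ closedBall c (η / 16) := mem_closedBall_iff_norm.2 hs₀c
  have hFs₀ : F s₀ ≠ 0 := h.ne_zero s₀ hs₀1
  have hψs₀ := hψ s₀ hs₀ball hFs₀
  -- `ρ = β + iγ ∈ S`
  set ρ : ℂ := β + γ * I with hρ
  have hρS : ρ ∈ S := by
    refine hS' ρ hzero ?_
    have : ρ - c = ((β - 1 - η / 32 : ℝ) : ℂ) := by simp only [hρ, hcdef]; push_cast; ring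
    rw [this, Complex.norm_real, Real.norm_eq_abs, abs_le]
    constructor <;> linarith
  have hSre : ∀ a ∈ S, a.re < s₀.re := by
    intro a ha
    have := h.re_le_one_of_zero (hS a ha).1
    rw [hs₀re]; linarith
  obtain ⟨-, hge⟩ := ClassicalZFRData.re_sum_div_ge (m := m) hSre
  have hρterm : ((s₀ - ρ)⁻¹).re = 1 / (1 + d - β) := by
    have : s₀ - ρ = ((1 + d - β : ℝ) : ℂ) := by simp only [hs₀, hρ]; push_cast; ring
    rw [this, ← Complex.ofReal_inv, Complex.ofReal_re, one_div]
  have hsum_ge := hge ρ hρS (hS ρ hρS).2.1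
  rw [hρterm] at hsum_ge
  -- `Re L(Λ₁, s₀) = −Re (ψ(s₀) + ∑)`
  have hL : LSeries Λ₁ s₀ = -(ψ s₀ + ∑ a ∈ S, (m a : ℂ) / (s₀ - a)) := by
    rw [hψs₀, h.logDeriv_eq s₀ hs₀1]; ring
  rw [hL, Complex.neg_re, Complex.add_re]
  have := (Complex.abs_re_le_norm (ψ s₀)).trans (hψb s₀ hs₀cl)
  linarith [neg_abs_le (ψ s₀).re, le_abs_self (ψ s₀).re]

/-- Third inequality of MV (11.2) (no zero needed): for `0 < δ ≤ 3η/32` and real `t`,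
`Re L(Λ₁, 1 + δ + it) ≤ E 𝓛(t)`.
[cite: MontgomeryVaughan2007, Theorem 11.3 (proof, eq. (11.2))] -/
theorem re_LSeries₁_le {E : ℝ}
    (hpack : ∀ t : ℝ, ∃ (S : Finset ℂ) (m : ℂ → ℕ) (ψ : ℂ → ℂ),
      (∀ a ∈ S, F a = 0 ∧ 0 < m a ∧ ‖a - (1 + η / 32 + t * I)‖ ≤ η / 4) ∧
      (∀ a, F a = 0 → ‖a - (1 + η / 32 + t * I)‖ ≤ η / 4 → a ∈ S) ∧
      (∀ z ∈ ball (1 + η / 32 + t * I) (η / 4), F z ≠ 0 →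
        ψ z = deriv F z / F z - ∑ a ∈ S, (m a : ℂ) / (z - a)) ∧
      (∀ z ∈ closedBall (1 + η / 32 + t * I) (η / 16),
        ‖ψ z‖ ≤ E * (𝓛 t)))
    {d : ℝ} (hd : 0 < d) (hd1 : d ≤ 3 * η / 32) (t : ℝ) :
    (LSeries Λ₁ (((1 + d : ℝ) : ℂ) + t * I)).re ≤ E * (𝓛 t) := by
  have hη := h.eta_pos
  obtain ⟨S, m, ψ, hS, -, hψ, hψb⟩ := hpack t
  set s₀ : ℂ := ((1 + d : ℝ) : ℂ) + t * I with hs₀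
  have hs₀re : s₀.re = 1 + d := by simp [hs₀]
  have hs₀1 : 1 < s₀.re := by rw [hs₀re]; linarith
  set c : ℂ := 1 + η / 32 + t * I with hcdef
  have hs₀c : ‖s₀ - c‖ ≤ η / 16 := by
    have : s₀ - c = ((d - η / 32 : ℝ) : ℂ) := by simp only [hs₀, hcdef]; push_cast; ring
    rw [this, Complex.norm_real, Real.norm_eq_abs, abs_le]
    constructor <;> linarith
  have hs₀ball : s₀ ∈ ball c (η / 4) := mem_ball_iff_norm.2 (by linarith)
  have hs₀cl : s₀ ∈ closedBall c (η / 16) := mem_closedBall_iff_norm.2 hs₀c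
  have hFs₀ : F s₀ ≠ 0 := h.ne_zero s₀ hs₀1
  have hψs₀ := hψ s₀ hs₀ball hFs₀
  have hSre : ∀ a ∈ S, a.re < s₀.re := by
    intro a ha
    have := h.re_le_one_of_zero (hS a ha).1
    rw [hs₀re]; linarith
  obtain ⟨hnn, -⟩ := ClassicalZFRData.re_sum_div_ge (m := m) hSre
  have hL : LSeries Λ₁ s₀ = -(ψ s₀ + ∑ a ∈ S, (m a : ℂ) / (s₀ - a)) := by
    rw [hψs₀, h.logDeriv_eq s₀ hs₀1]; ring
  rw [hL, Complex.neg_re, Complex.add_re]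
  have := (Complex.abs_re_le_norm (ψ s₀)).trans (hψb s₀ hs₀cl)
  linarith [neg_abs_le (ψ s₀).re, le_abs_self (ψ s₀).re]

/-- **Case 3 input** (MV (11.3)): in the `pole` case, for a zero `β + iγ` with `γ ≠ 0` and
`|(β + iγ) − (1 + η/32)| ≤ η/4`, and `0 < δ ≤ 3η/32`,
`Re L(Λ₁, 1 + δ) ≤ E 𝓛(0) − 2(1+δ−β)/((1+δ−β)² + γ²)`, the zeros `β ± iγ` (reflection)
both lying in the disc at height `0`. [cite: MontgomeryVaughan2007, Theorem 11.3 (proof, Case 3, eq. (11.3))] -/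
theorem re_LSeries₁_real_le_of_pair (hpole : pole = true) {E : ℝ}
    (hpack : ∀ t : ℝ, ∃ (S : Finset ℂ) (m : ℂ → ℕ) (ψ : ℂ → ℂ),
      (∀ a ∈ S, F a = 0 ∧ 0 < m a ∧ ‖a - (1 + η / 32 + t * I)‖ ≤ η / 4) ∧
      (∀ a, F a = 0 → ‖a - (1 + η / 32 + t * I)‖ ≤ η / 4 → a ∈ S) ∧
      (∀ z ∈ ball (1 + η / 32 + t * I) (η / 4), F z ≠ 0 →
        ψ z = deriv F z / F z - ∑ a ∈ S, (m a : ℂ) / (z - a)) ∧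
      (∀ z ∈ closedBall (1 + η / 32 + t * I) (η / 16),
        ‖ψ z‖ ≤ E * (𝓛 t)))
    {β γ d : ℝ} (hzero : F (β + γ * I) = 0) (hγ : γ ≠ 0)
    (hnear : ‖(β + γ * I : ℂ) - (1 + η / 32)‖ ≤ η / 4) (hd : 0 < d) (hd1 : d ≤ 3 * η / 32) :
    (LSeries Λ₁ ((1 + d : ℝ) : ℂ)).re ≤
      E * (𝓛 0) -
        2 * ((1 + d - β) / ((1 + d - β) ^ 2 + γ ^ 2)) := by
  have hη := h.eta_pos
  obtain ⟨S, m, ψ, hS, hS', hψ, hψb⟩ := hpack 0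
  set c : ℂ := 1 + η / 32 + ((0 : ℝ) : ℂ) * I with hcdef
  have hc : c = 1 + η / 32 := by simp [hcdef]
  set s₀ : ℂ := ((1 + d : ℝ) : ℂ) with hs₀
  have hs₀re : s₀.re = 1 + d := by simp [hs₀]
  have hs₀1 : 1 < s₀.re := by rw [hs₀re]; linarith
  have hs₀c : ‖s₀ - c‖ ≤ η / 16 := by
    have : s₀ - c = ((d - η / 32 : ℝ) : ℂ) := by rw [hc, hs₀]; push_cast; ring
    rw [this, Complex.norm_real, Real.norm_eq_abs, abs_le]
    constructor <;> linarith
  have hs₀ball : s₀ ∈ ball c (η / 4) := mem_ball_iff_norm.2 (by linarith)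
  have hs₀cl : s₀ ∈ closedBall c (η / 16) := mem_closedBall_iff_norm.2 hs₀c
  have hFs₀ : F s₀ ≠ 0 := h.ne_zero s₀ hs₀1
  have hψs₀ := hψ s₀ hs₀ball hFs₀
  -- the two zeros
  set ρ₁ : ℂ := β + γ * I with hρ₁
  set ρ₂ : ℂ := conj ρ₁ with hρ₂
  have hρ₂eq : ρ₂ = β - γ * I := by
    rw [hρ₂, hρ₁, map_add, map_mul, Complex.conj_ofReal, Complex.conj_ofReal, Complex.conj_I]
    ring
  have hρ₁re : 1 - η < ρ₁.re := by
    have h1 : |(ρ₁ - (1 + η / 32)).re| ≤ ‖ρ₁ - (1 + η / 32)‖ := Complex.abs_re_le_norm _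
    have hre : (ρ₁ - (1 + η / 32)).re = β - (1 + η / 32) := by simp [hρ₁]
    rw [hre] at h1
    have := neg_abs_le (β - (1 + η / 32))
    have hb : ρ₁.re = β := by simp [hρ₁]
    rw [hb]; linarith
  have hzero₂ : F ρ₂ = 0 := h.reflect hpole ρ₁ hρ₁re hzero
  have hρ₁S : ρ₁ ∈ S := hS' ρ₁ hzero (by rw [hc]; exact hnear)
  have hρ₂S : ρ₂ ∈ S := by
    refine hS' ρ₂ hzero₂ ?_
    rw [hc, hρ₂]
    have : (1 + (η : ℂ) / 32) = conj (1 + (η : ℂ) / 32) := by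
      simp [map_div₀, map_ofNat, Complex.conj_ofReal]
    rw [this, ← map_sub, Complex.norm_conj]
    exact hnear
  have hne : ρ₁ ≠ ρ₂ := by
    intro h'
    have := congrArg Complex.im h'
    rw [hρ₂eq, hρ₁] at this
    simp at this
    exact hγ (by linarith)
  have hSre : ∀ a ∈ S, a.re < s₀.re := by
    intro a ha
    have := h.re_le_one_of_zero (hS a ha).1
    rw [hs₀re]; linarith
  have hpair := DirichletZFR.re_sum_div_ge_pair hSre (fun a ha ↦ (hS a ha).2.1) hρ₁S hρ₂S hne
  have h₁ : ((s₀ - ρ₁)⁻¹).re = (1 + d - β) / ((1 + d - β) ^ 2 + γ ^ 2) := by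
    have : s₀ - ρ₁ = ((1 + d - β : ℝ) : ℂ) + ((-γ : ℝ) : ℂ) * I := by
      rw [hs₀, hρ₁]; push_cast; ring
    rw [this, DirichletZFR.re_inv_ofReal_add_mul_I]; ring
  have h₂ : ((s₀ - ρ₂)⁻¹).re = (1 + d - β) / ((1 + d - β) ^ 2 + γ ^ 2) := by
    have : s₀ - ρ₂ = ((1 + d - β : ℝ) : ℂ) + ((γ : ℝ) : ℂ) * I := by
      rw [hs₀, hρ₂eq]; push_cast; ring
    rw [this, DirichletZFR.re_inv_ofReal_add_mul_I]
  rw [h₁, h₂] at hpair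
  have hL : LSeries Λ₁ s₀ = -(ψ s₀ + ∑ a ∈ S, (m a : ℂ) / (s₀ - a)) := by
    rw [hψs₀, h.logDeriv_eq s₀ hs₀1]; ring
  rw [hL, Complex.neg_re, Complex.add_re]
  have hψn := (Complex.abs_re_le_norm (ψ s₀)).trans (hψb s₀ hs₀cl)
  have hψre : -(ψ s₀).re ≤ E * (𝓛 0) := by
    linarith [neg_abs_le (ψ s₀).re]
  have hsum : 2 * ((1 + d - β) / ((1 + d - β) ^ 2 + γ ^ 2)) ≤
      (∑ a ∈ S, (m a : ℂ) / (s₀ - a)).re := by linarith [hpair]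
  linear_combination hψre + hsum

/-- The companion bound at `1 + δ + iu` with the pole term evaluated:
`Re L(Λ₂, 1 + δ + iu) ≤ δ/(δ² + u²) + C₂ 𝓛(u)` for `0 < δ ≤ 1`.
[cite: MontgomeryVaughan2007, Theorem 11.3 (proof, Case 2)] -/
theorem re_LSeries₂_le_of_pos {d : ℝ} (hd : 0 < d) (hd1 : d ≤ 1) (u : ℝ) :
    (LSeries Λ₂ (((1 + d : ℝ) : ℂ) + u * I)).re ≤
      d / (d ^ 2 + u ^ 2) + C₂ * (𝓛 u) := by
  set s : ℂ := ((1 + d : ℝ) : ℂ) + u * I with hs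
  have hsre : s.re = 1 + d := by simp [hs]
  have hsim : s.im = u := by simp [hs]
  have h1 := h.re_LSeries₂_le_pole s (by rw [hsre]; linarith) (by rw [hsre]; linarith)
  rw [hsim] at h1
  have h2 : (1 / (s - 1)).re = d / (d ^ 2 + u ^ 2) := by
    have : s - 1 = ((d : ℝ) : ℂ) + ((u : ℝ) : ℂ) * I := by rw [hs]; push_cast; ring
    rw [one_div, this, DirichletZFR.re_inv_ofReal_add_mul_I]
  linarith

end Inequalities

/-! ## The cases of the proof of MV Theorem 11.3 -/

section Cases

variable (h : DegreeUniformTwistedZFRData η G G' K₀ C₂ pole 𝓛 Λ₀ Λ₁ Λ₂ F)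
include h

/-- **A zero on the line `σ = 1` off the real axis is impossible** (this replaces the input
"`L(1 + it, χ) ≠ 0`", not assumed here): if `F(1 + iγ) = 0` with `γ ≠ 0`, then `3-4-1` at
`σ = 1 + δ` gives `1/δ ≤ 3K₀ℒ₀ + (4E + 2C₂)ℒ + 1/(4|γ|)` for every small `δ > 0`
(`δ/(δ² + 4γ²) ≤ 1/(4|γ|)`), which fails for `δ` small. [cite: MontgomeryVaughan2007, Theorem 11.3 (proof)] -/
theorem not_zero_of_re_eq_one {E : ℝ} (hE : 0 ≤ E)
    (hpack : ∀ t : ℝ, ∃ (S : Finset ℂ) (m : ℂ → ℕ) (ψ : ℂ → ℂ),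
      (∀ a ∈ S, F a = 0 ∧ 0 < m a ∧ ‖a - (1 + η / 32 + t * I)‖ ≤ η / 4) ∧
      (∀ a, F a = 0 → ‖a - (1 + η / 32 + t * I)‖ ≤ η / 4 → a ∈ S) ∧
      (∀ z ∈ ball (1 + η / 32 + t * I) (η / 4), F z ≠ 0 →
        ψ z = deriv F z / F z - ∑ a ∈ S, (m a : ℂ) / (z - a)) ∧
      (∀ z ∈ closedBall (1 + η / 32 + t * I) (η / 16),
        ‖ψ z‖ ≤ E * (𝓛 t)))
    {β γ : ℝ} (hzero : F (β + γ * I) = 0) (hβ : β = 1) (hγ : γ ≠ 0) : False := by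
  have hη := h.eta_pos
  have hη1 := h.eta_le_one
  have hK₀ := h.K₀_nonneg
  have hC₂ := h.C₂_nonneg
  set ℒ : ℝ := 𝓛 γ with hℒ
  have hℒ1 : 1 ≤ ℒ := h.one_le_ell γ
  have hℒ₀1 : 1 ≤ 𝓛 0 := h.one_le_ell 0
  have hγ0 : 0 < |γ| := abs_pos.2 hγ
  obtain ⟨X, hX⟩ : ∃ X : ℝ, X = 3 * (K₀ * (𝓛 0)) + 4 * (E * ℒ) + 2 * C₂ * ℒ +
      1 / (4 * |γ|) := ⟨_, rfl⟩
  have hX0 : 0 ≤ X := by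
    rw [hX]
    have : 0 ≤ K₀ * (𝓛 0) := mul_nonneg hK₀ (by linarith)
    positivity
  have h32 : 0 < 32 / (3 * η) := by positivity
  obtain ⟨d, hddef⟩ : ∃ d : ℝ, d = 1 / (X + 32 / (3 * η) + 1) := ⟨_, rfl⟩
  have hden : 0 < X + 32 / (3 * η) + 1 := by positivity
  have hdpos : 0 < d := by rw [hddef]; positivity
  have hd_inv : 1 / d = X + 32 / (3 * η) + 1 := by rw [hddef, one_div_one_div]
  have hd1 : d ≤ 3 * η / 32 := by
    have h1 : d ≤ 1 / (32 / (3 * η)) := by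
      rw [hddef]
      exact div_le_div_of_nonneg_left zero_le_one h32 (by linarith)
    rw [one_div_div] at h1
    linarith
  have hd1' : d ≤ 1 := by linarith
  -- the three inequalities at `σ = 1 + d`
  have hA := h.re_LSeries₀_le_of_pos hdpos hd1'
  have hB := h.re_LSeries₁_le_of_zero hpack hzero (by rw [hβ]; linarith) hdpos hd1
  rw [hβ, show 1 + d - (1 : ℝ) = d by ring] at hB
  have hC := h.re_LSeries₂_le_of_pos hdpos hd1' (2 * γ)
  have h341 := h.three_four_one (1 + d) (by linarith) γ
  have hpt : ((1 + d : ℝ) : ℂ) + 2 * γ * I = ((1 + d : ℝ) : ℂ) + ((2 * γ : ℝ) : ℂ) * I := by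
    push_cast; ring
  rw [hpt] at h341
  -- the pole term `d/(d² + 4γ²) ≤ 1/(4|γ|)`
  have hpole : d / (d ^ 2 + (2 * γ) ^ 2) ≤ 1 / (4 * |γ|) := by
    rw [div_le_div_iff₀ (by positivity) (by positivity)]
    have hsq : (2 * γ) ^ 2 = 4 * |γ| ^ 2 := by rw [mul_pow, sq_abs]; norm_num
    rw [hsq]
    nlinarith [sq_nonneg (d - 2 * |γ|)]
  have h2 := h.ell_two_mul_le γ
  have hC' : (LSeries Λ₂ (((1 + d : ℝ) : ℂ) + ((2 * γ : ℝ) : ℂ) * I)).re ≤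
      1 / (4 * |γ|) + 2 * C₂ * ℒ := by
    refine hC.trans ?_
    have : C₂ * 𝓛 (2 * γ) ≤ C₂ * (2 * ℒ) :=
      mul_le_mul_of_nonneg_left h2 hC₂
    linarith
  -- combine: `1/d ≤ X`
  have hkey : 1 / d ≤ 3 * (K₀ * (𝓛 0)) + 4 * (E * ℒ) + 2 * C₂ * ℒ +
      1 / (4 * |γ|) := by
    linear_combination h341 + 3 * hA + 4 * hB + hC'
  rw [hd_inv, ← hX] at hkey
  linarith

/-- **Case 1 of MV Theorem 11.3** (no pole, e.g. complex `ν²`): a zero `β + iγ` of `F` with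
`β ≥ 1 − 7η/32` satisfies `1 − β ≥ 1/(14 E₁ ℒ)`, `ℒ = 𝓛(γ)`,
`E₁ = 3K₀ + 4E + 2C₂ + 6/η`: from `3-4-1` and (11.2), `4/(1 + δ − β) ≤ 3/δ + E₁ ℒ`
(`K₀ 𝓛(0) ≤ K₀ℒ`), and
`δ = 1/(2E₁ℒ) (≤ 3η/32)` gives the claim. [cite: MontgomeryVaughan2007, Theorem 11.3 (proof, Case 1)] -/
theorem one_sub_re_ge_of_noPole (hpole : pole = false) {E : ℝ} (hE : 0 ≤ E)
    (hpack : ∀ t : ℝ, ∃ (S : Finset ℂ) (m : ℂ → ℕ) (ψ : ℂ → ℂ),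
      (∀ a ∈ S, F a = 0 ∧ 0 < m a ∧ ‖a - (1 + η / 32 + t * I)‖ ≤ η / 4) ∧
      (∀ a, F a = 0 → ‖a - (1 + η / 32 + t * I)‖ ≤ η / 4 → a ∈ S) ∧
      (∀ z ∈ ball (1 + η / 32 + t * I) (η / 4), F z ≠ 0 →
        ψ z = deriv F z / F z - ∑ a ∈ S, (m a : ℂ) / (z - a)) ∧
      (∀ z ∈ closedBall (1 + η / 32 + t * I) (η / 16),
        ‖ψ z‖ ≤ E * (𝓛 t)))
    {β γ : ℝ} (hzero : F (β + γ * I) = 0) (hβ : 1 - 7 * η / 32 ≤ β) :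
    1 / (14 * (3 * K₀ + 4 * E + 2 * C₂ + 6 / η) * (𝓛 γ)) ≤ 1 - β := by
  have hη := h.eta_pos
  have hη1 := h.eta_le_one
  have hK₀ := h.K₀_nonneg
  have hC₂ := h.C₂_nonneg
  set E₁ : ℝ := 3 * K₀ + 4 * E + 2 * C₂ + 6 / η with hE₁
  have hℒ1 : 1 ≤ 𝓛 γ := h.one_le_ell γ
  have hℒ0 : 0 < 𝓛 γ := by linarith
  have h6η : 6 ≤ 6 / η := by rw [le_div_iff₀ hη]; nlinarith
  have hE₁6 : 6 / η ≤ E₁ := by rw [hE₁]; linarith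
  have h6pos : 0 < 6 / η := by positivity
  have hE₁0 : 0 < E₁ := by linarith
  have hβ1 : β ≤ 1 := by have := h.re_le_one_of_zero hzero; simpa using this
  -- `δ = 1/(2 E₁ ℒ)`
  set d : ℝ := 1 / (2 * E₁ * (𝓛 γ)) with hddef
  have hdpos : 0 < d := by positivity
  have hd1 : d ≤ 3 * η / 32 := by
    have h1 : d ≤ 1 / (2 * E₁) := by
      rw [hddef]; exact div_le_div_of_nonneg_left zero_le_one (by positivity) (by nlinarith)
    have h2 : 1 / (2 * E₁) ≤ 1 / (2 * (6 / η)) :=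
      div_le_div_of_nonneg_left zero_le_one (by positivity) (by linarith)
    have h3 : 1 / (2 * (6 / η)) = η / 12 := by field_simp; ring
    linarith
  have hd1' : d ≤ 1 := by linarith
  -- the three inequalities
  have hA := h.re_LSeries₀_le_of_pos hdpos hd1'
  have hB := h.re_LSeries₁_le_of_zero hpack hzero hβ hdpos hd1
  have hC := h.re_LSeries₂_le_noPole hpole (((1 + d : ℝ) : ℂ) + ((2 * γ : ℝ) : ℂ) * I)
    (by simp; linarith) (by simp; linarith)
  have h341 := h.three_four_one (1 + d) (by linarith) γ
  have hpt : ((1 + d : ℝ) : ℂ) + 2 * γ * I = ((1 + d : ℝ) : ℂ) + ((2 * γ : ℝ) : ℂ) * I := by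
    push_cast; ring
  rw [hpt] at h341
  have h2 := h.ell_two_mul_le γ
  set ℒ : ℝ := 𝓛 γ with hℒ
  have hC' : (LSeries Λ₂ (((1 + d : ℝ) : ℂ) + ((2 * γ : ℝ) : ℂ) * I)).re ≤ 2 * C₂ * ℒ := by
    refine hC.trans ?_
    have him : (((1 + d : ℝ) : ℂ) + ((2 * γ : ℝ) : ℂ) * I).im = 2 * γ := by simp
    rw [him]
    calc C₂ * 𝓛 (2 * γ) ≤ C₂ * (2 * ℒ) := by gcongr
      _ = 2 * C₂ * ℒ := by ring
  -- `4/(1+δ−β) ≤ 3/δ + (3K₀ + 4E + 2C₂)ℒ ≤ 7 E₁ ℒ`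
  have hkey : 4 / (1 + d - β) ≤ 7 * E₁ * ℒ := by
    have h3d : 3 / d = 6 * E₁ * ℒ := by rw [hddef]; field_simp; norm_num
    have hK₀ℒ : K₀ * (𝓛 0) ≤ K₀ * ℒ :=
      mul_le_mul_of_nonneg_left (h.ell_zero_le γ) hK₀
    have h6 : 4 / (1 + d - β) ≤
        3 / d + 3 * (K₀ * (𝓛 0)) + 4 * (E * ℒ) + 2 * C₂ * ℒ := by
      linear_combination h341 + 3 * hA + 4 * hB + hC'
    have h7 : 3 * (K₀ * ℒ) + 4 * (E * ℒ) + 2 * C₂ * ℒ ≤ E₁ * ℒ := by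
      rw [hE₁]
      have : 0 ≤ 6 / η * ℒ := by positivity
      nlinarith
    linarith
  -- conclude
  have hpos : 0 < 1 + d - β := by linarith
  have hgap : 4 / (7 * E₁ * ℒ) ≤ 1 + d - β := by
    rw [div_le_iff₀ (by positivity)]
    rw [div_le_iff₀ hpos] at hkey
    linarith
  have : 1 / (14 * E₁ * ℒ) = 4 / (7 * E₁ * ℒ) - d := by rw [hddef]; field_simp; norm_num
  linarith

/-- **Case 2 of MV Theorem 11.3** (`pole`, `|γ| ≥ 6(1 − β)`): a zero `β + iγ` of `F` with
`0 < 1 − β ≤ η/64` and `|γ| ≥ 6(1 − β)` satisfies `1 − β ≥ 4/(105 E₂ ℒ)`,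
`E₂ = 3K₀ + 4E + 2C₂ + 1`: with `δ = 6(1 − β)` the pole term is `δ/(δ² + 4γ²) ≤ 1/(30(1−β))`, and
`3/6 − 4/7 + 1/30 = −4/105`. [cite: MontgomeryVaughan2007, Theorem 11.3 (proof, Case 2)] -/
theorem one_sub_re_ge_of_pole_far {E : ℝ} (hE : 0 ≤ E)
    (hpack : ∀ t : ℝ, ∃ (S : Finset ℂ) (m : ℂ → ℕ) (ψ : ℂ → ℂ),
      (∀ a ∈ S, F a = 0 ∧ 0 < m a ∧ ‖a - (1 + η / 32 + t * I)‖ ≤ η / 4) ∧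
      (∀ a, F a = 0 → ‖a - (1 + η / 32 + t * I)‖ ≤ η / 4 → a ∈ S) ∧
      (∀ z ∈ ball (1 + η / 32 + t * I) (η / 4), F z ≠ 0 →
        ψ z = deriv F z / F z - ∑ a ∈ S, (m a : ℂ) / (z - a)) ∧
      (∀ z ∈ closedBall (1 + η / 32 + t * I) (η / 16),
        ‖ψ z‖ ≤ E * (𝓛 t)))
    {β γ : ℝ} (hzero : F (β + γ * I) = 0) (hβ1 : β < 1)
    (hsmall : 1 - β ≤ η / 64) (hfar : 6 * (1 - β) ≤ |γ|) :
    4 / (105 * (3 * K₀ + 4 * E + 2 * C₂ + 1) * (𝓛 γ)) ≤ 1 - β := by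
  have hη := h.eta_pos
  have hη1 := h.eta_le_one
  have hK₀ := h.K₀_nonneg
  have hC₂ := h.C₂_nonneg
  have hℒ1 : 1 ≤ 𝓛 γ := h.one_le_ell γ
  set u : ℝ := 1 - β with hu
  have hu0 : 0 < u := by rw [hu]; linarith
  set d : ℝ := 6 * u with hddef
  have hdpos : 0 < d := by positivity
  have hd1 : d ≤ 3 * η / 32 := by rw [hddef]; linarith
  have hd1' : d ≤ 1 := by linarith
  have hβ : 1 - 7 * η / 32 ≤ β := by linarith
  -- the three inequalities
  have hA := h.re_LSeries₀_le_of_pos hdpos hd1'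
  have hB := h.re_LSeries₁_le_of_zero hpack hzero hβ hdpos hd1
  have hCζ := h.re_LSeries₂_le_of_pos hdpos hd1' (2 * γ)
  have h341 := h.three_four_one (1 + d) (by linarith) γ
  have hpt : ((1 + d : ℝ) : ℂ) + 2 * γ * I = ((1 + d : ℝ) : ℂ) + ((2 * γ : ℝ) : ℂ) * I := by
    push_cast; ring
  rw [hpt] at h341
  have h2 := h.ell_two_mul_le γ
  set ℒ : ℝ := 𝓛 γ with hℒ
  have hℒ0 : 0 < ℒ := by linarith
  -- the pole term `δ/(δ² + 4γ²) ≤ 1/(30 u)`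
  have hγ2 : 36 * u ^ 2 ≤ γ ^ 2 := by
    have h6u : 0 ≤ 6 * u := by positivity
    have := mul_le_mul hfar hfar h6u (abs_nonneg γ)
    rw [← pow_two, ← pow_two, sq_abs] at this
    nlinarith
  have hpole : d / (d ^ 2 + (2 * γ) ^ 2) ≤ 1 / (30 * u) := by
    rw [div_le_div_iff₀ (by positivity) (by positivity), hddef]
    nlinarith
  have hC' : (LSeries Λ₂ (((1 + d : ℝ) : ℂ) + ((2 * γ : ℝ) : ℂ) * I)).re ≤
      1 / (30 * u) + 2 * C₂ * ℒ := by
    refine hCζ.trans ?_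
    have : C₂ * 𝓛 (2 * γ) ≤ C₂ * (2 * ℒ) :=
      mul_le_mul_of_nonneg_left h2 hC₂
    linarith
  -- combine: `(4/105)/u ≤ 3K₀ℒ₀ + (4E + 2C₂)ℒ ≤ E₂ ℒ`
  have h1d : 1 / d = 1 / (6 * u) := by rw [hddef]
  have h1β : 1 / (1 + d - β) = 1 / (7 * u) := by rw [hddef, hu]; ring_nf
  rw [h1d] at hA
  rw [h1β] at hB
  have hkey : (4 / 105) / u ≤ 3 * (K₀ * (𝓛 0)) + 4 * (E * ℒ) + 2 * C₂ * ℒ := by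
    have e : (4 / 105) / u = -(3 * (1 / (6 * u)) - 4 * (1 / (7 * u)) + 1 / (30 * u)) := by
      field_simp; norm_num
    rw [e]
    linear_combination h341 + 3 * hA + 4 * hB + hC'
  have hK₀ℒ : K₀ * (𝓛 0) ≤ K₀ * ℒ :=
    mul_le_mul_of_nonneg_left (h.ell_zero_le γ) hK₀
  set E₂ : ℝ := 3 * K₀ + 4 * E + 2 * C₂ + 1 with hE₂
  have hE₂0 : 0 < E₂ := by rw [hE₂]; positivity
  have hkey2 : (4 / 105) / u ≤ E₂ * ℒ := by
    have : 3 * (K₀ * ℒ) + 4 * (E * ℒ) + 2 * C₂ * ℒ ≤ E₂ * ℒ := by rw [hE₂]; nlinarith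
    linarith
  rw [div_le_iff₀ (by positivity)]
  rw [div_le_iff₀ hu0] at hkey2
  nlinarith

/-- **Case 3 of MV Theorem 11.3** (`pole`, `0 < |γ| < 6(1 − β)`): a zero `β + iγ` of `F` with
`γ ≠ 0`, `|γ| < 6(1 − β)` and `0 < 1 − β ≤ 3η/416` satisfies `1 − β ≥ 33/(754 E₃ 𝓛(0))`,
`E₃ = K₀ + E + 1`: at `σ = 1 + 13(1 − β)` the conjugate pair contributes
`2(σ−β)/((σ−β)² + γ²) ≥ 7/(58(1−β))` in (11.3)–(11.4), and `1/13 − 7/58 = −33/754`.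
[cite: MontgomeryVaughan2007, Theorem 11.3 (proof, Case 3)] -/
theorem one_sub_re_ge_of_pole_near (hpole : pole = true) {E : ℝ} (hE : 0 ≤ E)
    (hpack : ∀ t : ℝ, ∃ (S : Finset ℂ) (m : ℂ → ℕ) (ψ : ℂ → ℂ),
      (∀ a ∈ S, F a = 0 ∧ 0 < m a ∧ ‖a - (1 + η / 32 + t * I)‖ ≤ η / 4) ∧
      (∀ a, F a = 0 → ‖a - (1 + η / 32 + t * I)‖ ≤ η / 4 → a ∈ S) ∧
      (∀ z ∈ ball (1 + η / 32 + t * I) (η / 4), F z ≠ 0 →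
        ψ z = deriv F z / F z - ∑ a ∈ S, (m a : ℂ) / (z - a)) ∧
      (∀ z ∈ closedBall (1 + η / 32 + t * I) (η / 16),
        ‖ψ z‖ ≤ E * (𝓛 t)))
    {β γ : ℝ} (hzero : F (β + γ * I) = 0) (hγ : γ ≠ 0) (hβ1 : β < 1)
    (hsmall : 1 - β ≤ 3 * η / 416) (hnearγ : |γ| < 6 * (1 - β)) :
    33 / (754 * (K₀ + E + 1) * (𝓛 0)) ≤ 1 - β := by
  have hη := h.eta_pos
  have hη1 := h.eta_le_one
  have hK₀ := h.K₀_nonneg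
  have hℒ1 : 1 ≤ 𝓛 0 := h.one_le_ell 0
  set u : ℝ := 1 - β with hu
  have hu0 : 0 < u := by rw [hu]; linarith
  set d : ℝ := 13 * u with hddef
  have hdpos : 0 < d := by positivity
  have hd1 : d ≤ 3 * η / 32 := by rw [hddef]; linarith
  have hd1' : d ≤ 1 := by linarith
  -- the zero lies in the disc at height `0`
  have hnear : ‖(β + γ * I : ℂ) - (1 + η / 32)‖ ≤ η / 4 := by
    have h1 := Complex.norm_le_abs_re_add_abs_im ((β + γ * I : ℂ) - (1 + η / 32))
    have hre : ((β + γ * I : ℂ) - (1 + η / 32)).re = β - (1 + η / 32) := by simp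
    have him : ((β + γ * I : ℂ) - (1 + η / 32)).im = γ := by simp
    rw [hre, him] at h1
    have h2 : |β - (1 + η / 32)| ≤ η / 32 + u := by
      rw [abs_le]; constructor <;> linarith
    have h3 : |γ| ≤ 6 * u := hnearγ.le
    linarith
  -- the two inequalities
  have hA := h.re_LSeries₀_le_of_pos hdpos hd1'
  have hP := h.re_LSeries₁_real_le_of_pair hpole hpack hzero hγ hnear hdpos hd1
  have h114 := TwistedZFR.re_add_re_nonneg h.norm_le₁ h.summable (σ := 1 + d) (by linarith)
  set ℒ₀ : ℝ := 𝓛 0 with hℒ₀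
  have hℒ0 : 0 < ℒ₀ := by linarith
  -- the pair term `2(1+d−β)/((1+d−β)²+γ²) ≥ 7/(58u)`
  have hγ2 : γ ^ 2 ≤ 36 * u ^ 2 := by
    have h6u : 0 ≤ 6 * u := by positivity
    have := mul_le_mul hnearγ.le hnearγ.le (abs_nonneg γ) h6u
    rw [← pow_two, ← pow_two, sq_abs] at this
    nlinarith
  have h14 : 1 + d - β = 14 * u := by rw [hddef, hu]; ring
  rw [h14] at hP
  have hpair : 7 / (58 * u) ≤ 2 * ((14 * u) / ((14 * u) ^ 2 + γ ^ 2)) := by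
    rw [mul_div_assoc', div_le_div_iff₀ (by positivity) (by positivity)]
    nlinarith
  have h1d : 1 / d = 1 / (13 * u) := by rw [hddef]
  rw [h1d] at hA
  have hkey : (33 / 754) / u ≤ K₀ * ℒ₀ + E * ℒ₀ := by
    have e : (33 / 754) / u = -(1 / (13 * u) - 7 / (58 * u)) := by
      field_simp; norm_num
    rw [e]
    linear_combination h114 + hA + hP + hpair
  set E₃ : ℝ := K₀ + E + 1 with hE₃
  have hE₃0 : 0 < E₃ := by rw [hE₃]; positivity
  have hkey2 : (33 / 754) / u ≤ E₃ * ℒ₀ := by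
    have : K₀ * ℒ₀ + E * ℒ₀ ≤ E₃ * ℒ₀ := by rw [hE₃]; nlinarith
    linarith
  rw [div_le_iff₀ (by positivity)]
  rw [div_le_iff₀ hu0] at hkey2
  nlinarith

end Cases

/-! ## MV Theorem 11.3, abstract form -/

section ZeroFree

variable (h : DegreeUniformTwistedZFRData η G G' K₀ C₂ pole 𝓛 Λ₀ Λ₁ Λ₂ F)
include h

/-- **The zero-free region (Montgomery–Vaughan Theorem 11.3 / Lagarias–Odlyzko Lemma 8.1,
abstract form with a size functional).** Let `E = E(η, G, G')` be the package constant,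
`E₁ = 3K₀ + 4E + 2C₂ + 6/η`, `E₂ = 3K₀ + 4E + 2C₂ + 1`, `E₃ = K₀ + E + 1`. If
`0 < c ≤ min(1/(14E₁), 4/(105E₂), 33/(754E₃), 3η/416)` — a bound depending only on
`η, G, G', K₀, C₂`, NOT on the size functional `𝓛` — then every zero `ρ = β + iγ` of `F` with
`β > 1 − c/𝓛(γ)` is real, and exists only if `pole = true`. Proof: Case 1 if `pole = false`; if
`pole = true` and `γ ≠ 0`: `β = 1` is excluded by `not_zero_of_re_eq_one`, and `β < 1` by Cases 2
(`|γ| ≥ 6(1−β)`) and 3 (`|γ| < 6(1−β)`).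
[cite: MontgomeryVaughan2007, Theorem 11.3; LagariasOdlyzko1977, Lemma 8.1] -/
theorem zeroFree_of_le {c : ℝ} (hc : 0 < c)
    (hc1 : c ≤ 1 / (14 * (3 * K₀ + 4 * E[η, G, G'] + 2 * C₂ + 6 / η)))
    (hc2 : c ≤ 4 / (105 * (3 * K₀ + 4 * E[η, G, G'] + 2 * C₂ + 1)))
    (hc3 : c ≤ 33 / (754 * (K₀ + E[η, G, G'] + 1)))
    (hc4 : c ≤ 3 * η / 416)
    {ρ : ℂ} (hzero : F ρ = 0)
    (hregion : 1 - c / 𝓛 ρ.im < ρ.re) :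
    pole = true ∧ ρ.im = 0 := by
  have hη := h.eta_pos
  have hK₀ := h.K₀_nonneg
  have hC₂ := h.C₂_nonneg
  obtain ⟨E, hEdef⟩ : ∃ E : ℝ, E = E[η, G, G'] := ⟨_, rfl⟩
  have hE : 0 ≤ E := by rw [hEdef]; exact h.packageConst_nonneg
  rw [← hEdef] at hc1 hc2 hc3
  have hpack := h.exists_package
  rw [← hEdef] at hpack
  set E₁ : ℝ := 3 * K₀ + 4 * E + 2 * C₂ + 6 / η with hE₁
  set E₂ : ℝ := 3 * K₀ + 4 * E + 2 * C₂ + 1 with hE₂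
  set E₃ : ℝ := K₀ + E + 1 with hE₃
  have h6pos : 0 < 6 / η := by positivity
  have hE₁0 : 0 < E₁ := by rw [hE₁]; positivity
  have hE₂0 : 0 < E₂ := by rw [hE₂]; positivity
  have hE₃0 : 0 < E₃ := by rw [hE₃]; positivity
  set β : ℝ := ρ.re with hβdef
  set γ : ℝ := ρ.im with hγdef
  have hρ : ρ = β + γ * I := (Complex.re_add_im ρ).symm.trans (by simp [hβdef, hγdef, mul_comm])
  have hzero' : F (β + γ * I) = 0 := by rw [← hρ]; exact hzero
  set ℒ : ℝ := 𝓛 γ with hℒ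
  have hℒ1 : 1 ≤ ℒ := h.one_le_ell γ
  have hℒ0 : 0 < ℒ := by linarith
  have hβ1 : β ≤ 1 := h.re_le_one_of_zero hzero
  have hgap : 1 - β < c / ℒ := by linarith
  have hcℒ : c / ℒ ≤ c := div_le_self hc.le hℒ1
  have hsmall : 1 - β < 3 * η / 416 := by linarith
  have hβ' : 1 - 7 * η / 32 ≤ β := by linarith
  have hdiv : ∀ K' : ℝ, c ≤ K' → c / ℒ ≤ K' / ℒ := fun K' hK' ↦
    div_le_div_of_nonneg_right hK' hℒ0.le
  cases hp : pole with
  | false =>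
    -- Case 1
    exfalso
    subst hp
    have h1 := h.one_sub_re_ge_of_noPole rfl hE hpack hzero' hβ'
    have h' : 1 / (14 * E₁ * ℒ) = (1 / (14 * E₁)) / ℒ := by rw [div_div]
    rw [h'] at h1
    linarith [hdiv _ hc1]
  | true =>
    refine ⟨rfl, ?_⟩
    subst hp
    by_contra hγ0
    rcases eq_or_lt_of_le hβ1 with hβe | hβlt
    · exact h.not_zero_of_re_eq_one hE hpack hzero' hβe hγ0
    rcases le_or_gt (6 * (1 - β)) |γ| with hfar | hnear
    · -- Case 2
      have h2 := h.one_sub_re_ge_of_pole_far hE hpack hzero' hβlt (by linarith) hfar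
      have h' : 4 / (105 * E₂ * ℒ) = (4 / (105 * E₂)) / ℒ := by rw [div_div]
      rw [h'] at h2
      linarith [hdiv _ hc2]
    · -- Case 3
      have h3 := h.one_sub_re_ge_of_pole_near rfl hE hpack hzero' hγ0 hβlt hsmall.le hnear
      set ℒ₀ : ℝ := 𝓛 0 with hℒ₀
      have hℒ₀1 : 1 ≤ ℒ₀ := h.one_le_ell 0
      have hℒ₀ℒ : ℒ₀ ≤ ℒ := h.ell_zero_le γ
      have h' : 33 / (754 * E₃ * ℒ₀) = (33 / (754 * E₃)) / ℒ₀ := by rw [div_div]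
      rw [h'] at h3
      have h4 : (33 / (754 * E₃)) / ℒ ≤ (33 / (754 * E₃)) / ℒ₀ :=
        div_le_div_of_nonneg_left (by positivity) (by linarith) hℒ₀ℒ
      linarith [hdiv _ hc3]

end ZeroFree

/-- **The zero-free region with the constant quantified before the data**: for all numeric
parameters `η > 0`, `G, G', K₀, C₂ ≥ 0` there is `c > 0` such that for EVERY datum
`DegreeUniformTwistedZFRData η G G' K₀ C₂ pole 𝓛 Λ₀ Λ₁ Λ₂ F` (any size functional `𝓛`, any
twist), every zero `ρ` of `F` with `Re ρ > 1 − c/𝓛(Im ρ)` is real and `pole = true`.  With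
`𝓛(t) = log|d_K| + n_K log(|t| + 4) + O(n_K)` this is the uniformity in the field, ITS DEGREE and the
character of Lagarias–Odlyzko Lemma 8.1 / Thorner–Zaman Theorem 3.1 (region
`σ > 1 − c/log(d_K (|t|+3)^{n_K})`, `c` absolute).
[cite: MontgomeryVaughan2007, Theorem 11.3; LagariasOdlyzko1977, Lemma 8.1] -/
theorem exists_zeroFree_const {η G G' K₀ C₂ : ℝ} (hη : 0 < η) (hG : 0 ≤ G) (hG' : 0 ≤ G')
    (hK₀ : 0 ≤ K₀) (hC₂ : 0 ≤ C₂) :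
    ∃ c : ℝ, 0 < c ∧ ∀ (pole : Bool) (𝓛 : ℝ → ℝ) (Λ₀ : ℕ → ℝ) (Λ₁ Λ₂ : ℕ → ℂ) (F : ℂ → ℂ),
      DegreeUniformTwistedZFRData η G G' K₀ C₂ pole 𝓛 Λ₀ Λ₁ Λ₂ F → ∀ ρ : ℂ, F ρ = 0 →
        1 - c / 𝓛 ρ.im < ρ.re → pole = true ∧ ρ.im = 0 := by
  obtain ⟨E, hEdef⟩ : ∃ E : ℝ, E = E[η, G, G'] := ⟨_, rfl⟩
  have hE : 0 ≤ E := by rw [hEdef]; positivity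
  set E₁ : ℝ := 3 * K₀ + 4 * E + 2 * C₂ + 6 / η with hE₁
  set E₂ : ℝ := 3 * K₀ + 4 * E + 2 * C₂ + 1 with hE₂
  set E₃ : ℝ := K₀ + E + 1 with hE₃
  have h6pos : 0 < 6 / η := by positivity
  have hE₁0 : 0 < E₁ := by rw [hE₁]; positivity
  have hE₂0 : 0 < E₂ := by rw [hE₂]; positivity
  have hE₃0 : 0 < E₃ := by rw [hE₃]; positivity
  set c : ℝ := min (min (1 / (14 * E₁)) (4 / (105 * E₂))) (min (33 / (754 * E₃)) (3 * η / 416))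
    with hcdef
  have hc1 : c ≤ 1 / (14 * E₁) := (min_le_left _ _).trans (min_le_left _ _)
  have hc2 : c ≤ 4 / (105 * E₂) := (min_le_left _ _).trans (min_le_right _ _)
  have hc3 : c ≤ 33 / (754 * E₃) := (min_le_right _ _).trans (min_le_left _ _)
  have hc4 : c ≤ 3 * η / 416 := (min_le_right _ _).trans (min_le_right _ _)
  have hcpos : 0 < c := lt_min (lt_min (by positivity) (by positivity))
    (lt_min (by positivity) (by positivity))
  refine ⟨c, hcpos, fun pole 𝓛 Λ₀ Λ₁ Λ₂ F h ρ hzero hregion ↦ ?_⟩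
  rw [hE₁, hEdef] at hc1
  rw [hE₂, hEdef] at hc2
  rw [hE₃, hEdef] at hc3
  exact h.zeroFree_of_le hcpos hc1 hc2 hc3 hc4 hzero hregion

/-- **The size-functional datum generalises the uniform datum**: every
`UniformTwistedZFRData η A C_g c₁ K₀ C₂ pole Q Λ₀ Λ₁ Λ₂ F` is a `DegreeUniformTwistedZFRData` with
`𝓛(t) = log Q + log(|t| + 4)`, `G = A + |log C_g|`, `G' = |log(c₁η/32)|` and the same `K₀`, `C₂`
(`C_g Q^A (|t|+4)^A = C_g e^{A 𝓛(t)} ≤ e^{(A + |log C_g|)𝓛(t)}`, `c₁η/32 ≥ e^{−|log(c₁η/32)| 𝓛(t)}`),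
so that the theorems of this file contain those of `UniformTwistedZeroFreeRegion.lean` (and of
`TwistedZeroFreeRegion.lean`, by `UniformTwistedZFRData.of_twistedZFRData`). [folklore] -/
theorem of_uniformTwistedZFRData {A Cg c₁ Q : ℝ}
    (h : UniformTwistedZFRData η A Cg c₁ K₀ C₂ pole Q Λ₀ Λ₁ Λ₂ F) :
    DegreeUniformTwistedZFRData η (A + |Real.log Cg|) |Real.log (c₁ * (η / 32))| K₀ C₂ pole
      (fun t ↦ Real.log Q + Real.log (|t| + 4)) Λ₀ Λ₁ Λ₂ F where
  eta_pos := h.eta_pos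
  eta_le_one := h.eta_le_one
  G_nonneg := add_nonneg h.A_nonneg (abs_nonneg _)
  G'_nonneg := abs_nonneg _
  K₀_nonneg := h.K₀_nonneg
  C₂_nonneg := h.C₂_nonneg
  one_le_ell t := TwistedZFR.one_le_ell h.one_le_Q t
  ell_two_mul_le t := TwistedZFR.ell_two_mul_le h.one_le_Q t
  ell_zero_le t := by simpa only [abs_zero] using TwistedZFR.ell_zero_le Q t
  ell_le_of_near t t' ht := by
    have h1 : |t'| ≤ |t| + 1 := by
      have := abs_sub_abs_le_abs_sub t' t
      linarith
    have h2 := TwistedZFR.ell_le_of_abs_le h.one_le_Q h1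
    have h3 := TwistedZFR.one_le_ell h.one_le_Q t
    linarith
  nonneg := h.nonneg
  summable := h.summable
  re_LSeries₀_le σ hσ hσ2 := by
    have h1 := h.re_LSeries₀_le σ hσ hσ2
    simpa only [abs_zero, zero_add] using h1
  norm_le₁ := h.norm_le₁
  norm_le₂ := h.norm_le₂
  three_four_one := h.three_four_one
  differentiableOn := h.differentiableOn
  ne_zero := h.ne_zero
  logDeriv_eq := h.logDeriv_eq
  growth s hs1 hs2 := by
    have hQ := h.one_le_Q
    have hA := h.A_nonneg
    have hCg := h.Cg_pos
    have hℒ1 : 1 ≤ Real.log Q + Real.log (|s.im| + 4) := TwistedZFR.one_le_ell hQ s.im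
    refine (h.growth s hs1 hs2).trans ?_
    have hτ : 0 < |s.im| + 4 := by positivity
    rw [show Cg * Q ^ A * (|s.im| + 4) ^ A =
        Real.exp (Real.log Cg + A * (Real.log Q + Real.log (|s.im| + 4))) by
      rw [Real.exp_add, Real.exp_log hCg, mul_add, Real.exp_add,
        Real.rpow_def_of_pos (by linarith), Real.rpow_def_of_pos hτ]; ring_nf,
      Real.exp_le_exp]
    have h1 : Real.log Cg ≤ |Real.log Cg| * (Real.log Q + Real.log (|s.im| + 4)) :=
      (le_abs_self _).trans (le_mul_of_one_le_right (abs_nonneg _) hℒ1)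
    nlinarith
  lower t := by
    have hQ := h.one_le_Q
    have hη := h.eta_pos
    have hc₁ := h.c₁_pos
    have hℒ1 : 1 ≤ Real.log Q + Real.log (|t| + 4) := TwistedZFR.one_le_ell hQ t
    refine le_trans ?_ (h.lower t)
    have hpos : 0 < c₁ * (η / 32) := by positivity
    have h1 : -Real.log (c₁ * (η / 32)) ≤ |Real.log (c₁ * (η / 32))| := neg_le_abs _
    have h2 : |Real.log (c₁ * (η / 32))| ≤
        |Real.log (c₁ * (η / 32))| * (Real.log Q + Real.log (|t| + 4)) :=
      le_mul_of_one_le_right (abs_nonneg _) hℒ1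
    calc Real.exp (-(|Real.log (c₁ * (η / 32))| * (Real.log Q + Real.log (|t| + 4))))
        ≤ Real.exp (Real.log (c₁ * (η / 32))) := Real.exp_le_exp.2 (by linarith)
      _ = c₁ * (η / 32) := Real.exp_log hpos
  re_LSeries₂_le := h.re_LSeries₂_le
  reflect := h.reflect

end DegreeUniformTwistedZFRData

end Literature.NumberTheory.LFunctions
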